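import Literature.NumberTheory.LFunctions.Zhang2022.KnifeEdgeEStarLen
import Literature.NumberTheory.LFunctions.Zhang2022.KnifeEdgeInvisibleTailBlock

/-!
# Zhang (2022), rung F-S3 (Landau–Siegel programme, family B-len): registry row E-004 «E*-bandwidth» —
# the WIDTH bound for the discrete mean of a thin piece of a smooth profile, typed over the skeleton

Y. Zhang, *Discrete mean estimates and the Landau–Siegel zero*, arXiv:2211.02515v1 [Zhang2022LandauSiegel] —
an unrefereed manuscript under adjudication. **WHAT THIS IS NOT: not a claim about Theorems 1–2 of
arXiv:2211.02515, about Landau–Siegel zeros, or about Parity. The programme SEARCHES and TYPES; nothing here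
asserts any estimate: `DiscMeanUpperWidth`, `BandWidthBound`, `NearWallBound` are bare `Prop`s (registry row
E-004 of the cell's `obj/EDREGISTRY.md`, status «derivation (S–M), in-house, unreviewed»), and every `theorem`
is bookkeeping between them and the tree's parameters.**

**The object (registry row E-004, alias E*-bandwidth; OBJECTIVE.md v1.x §3.3; EDREGISTRY v1.10 row E-004:
«the band piece `z ∈ (1, 1+α̃]` (`α̃ = log(Dt₀)/log P = Skeleton.alphaTilde`) of a smooth top-vanishing profile
contributes `≤ C·width·discWeight` to the discrete mean (`DiscMeanUpperWidth`-type)»; role: error term (band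
bookkeeping); would it close if proved: NO (bound only; completes E-003 E*-inv); price M → S once typed with ONE
normalisation).** The F-S2 transfer card (`pub/zhang-knife/zhang-knife-transfer/Sketch.lean` l.160–178, def
`DiscMeanUpperWidth`) named the one input its invisibility chain ASSUMES: an upper bound of `H¹`-type (NOT the
`L²`-type large sieve `≪ Σ|a(n)|²/n`: Zhang's normalised main term contains `(8/π)∫|g′|²`, `mainTermForm_eq`, so
the `𝔠*(ρ,ψ)ω(ρ)`-weighted discrete mean sees the DERIVATIVE of the profile) for the discrete mean of the profile
polynomial of a `1`-Lipschitz profile bounded by `1` and supported on a `θ`-interval `[u, v] ⊂ [0, 1+δ]`: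

  `discMeanAbs(H_g) ≤ C · (v − u) · discWeight`  (under (A), for all large `D`),

where `discMeanAbs`/`discWeight` are the absolute-weight discrete mean and the total absolute weight
`Σ_{(ψ,ρ)} |Re 𝔠*(ρ,ψ)·Re ω(ρ)|` of `KnifeEdgeEStarLen.lean` Part 1 (the F-S2 vocabulary of record, p456081).
Consistent with `𝔅(g) ≤ C‖g‖²_{H¹} ≤ 2C(v − u)` INSIDE Zhang's range (`v ≤ 1 − o(1)`, Prop. 7.1) and an
ASSUMPTION on the band `[1 − o(1), 1 + ε]`; used ONLY to say that the piece of a profile VANISHING at the wall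
`z = 1` that lives in `[1, 1+ε]` contributes `→ 0` as `ε → 0` (every consequence labelled HEURISTIC by the cards).

**NORMALISATION (the registry's «unit systems to reconcile», stated once).** This file's statement is in the
TRIVIAL scale `discWeight = Σ|Re 𝔠* Re ω|` (no Deuring–Heilbronn amplification `𝔞`): «`≤ C·width·discWeight`».
ls-theory's band heuristic (zhang-knife INBOX 11:35:37Z; FEASIBILITY v1.0b §0.6) reads «a wall value `h` enters at
`h²𝓛^{1.1}` against the dipole-suppressed regular part `𝔞𝓛⁻⁹`» — that is a statement about profiles with
`g(1) = h ≠ 0`, i.e. registry row E-005 (E*-band, typed by the B-multi typers), NOT about this row: here `g` is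
`1`-Lipschitz on all of `ℝ` and vanishes off `[u, v]`, so `|g| ≤ (v − u)/2` on its support and there is no wall
value. The two rows meet only in the bookkeeping identity «profile = (profile − wall ramp) + wall ramp».

Contents: Part 1 — `DiscMeanUpperWidth c' δ` (the transfer card's `def`, BODY VERBATIM over the vocabulary of
record); Part 2 — the two instances the registry sentence and the cards actually use, as named `Prop`s:
`NearWallBound c' δ` (pieces in `[1, 1+ε]`, bound `C·ε·discWeight` for every `0 < ε ≤ δ`) and `BandWidthBound c' δ`
(pieces in the band `[1, 1+α̃(D)]`, bound `C·α̃(D)·discWeight`) — both PROVED to follow from `DiscMeanUpperWidth`;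
Part 3 — PROVED parameter facts: `alphaTilde_nonneg` (`α̃ ≥ 0` once `D ≥ 3`) and `alphaTilde_lt_eventually`
(`α̃(D) < ε` for all large `D`, every `ε > 0`; from `KnifeEdgeInvisibleTail.band_lt_rpow_one_add`, p455698: the band
is thinner than every fixed `ε`). Deliberately NOT here: E-005 (band variance for `g(1) ≠ 0`), E-006 (bulk × band
cross term) — B-multi typers per EDREGISTRY v1.10 / INBOX 16:38:24Z; any claim that `DiscMeanUpperWidth` holds.

References: Zhang, arXiv:2211.02515v1, §2 (2.14)–(2.20), (2.30) (`α̃`), Prop. 2.2; §7 Prop 7.1 (7.2)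
[cite: Zhang2022LandauSiegel, §2 (2.30), §7 Prop 7.1]; the tree's `mainTermForm_eq` (MainTermFormPSD.lean),
`KnifeEdge.profPoly/discMeanAbs/discWeight` (KnifeEdgeEStarLen.lean, p456081),
`KnifeEdgeInvisibleTail.band_lt_rpow_one_add` (KnifeEdgeInvisibleTailBlock.lean, p455698); transfer card
`pub/zhang-knife/zhang-knife-transfer/Sketch.lean` (`DiscMeanUpperWidth`, l.160–178) and CARD-invisible-tail.md;
cell files OBJECTIVE.md §1.3/§3.3, obj/EDREGISTRY.md row E-004, zhang-knife-ref/FEASIBILITY.md v1.0b §0.6.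
-/

noncomputable section

open Complex Real Set

namespace Literature.NumberTheory.LFunctions.Zhang2022

namespace KnifeEdge

open Repair Skeleton

/-! ### Part 1 — registry row E-004: the width bound (bare `Prop`, not asserted) -/

/-- **E-004 «E*-bandwidth» — the `H¹`-type WIDTH bound for the discrete mean of a thin Lipschitz piece**
(transfer card Sketch `DiscMeanUpperWidth`, body verbatim over the vocabulary of record): there is `C > 0` such
that for all large `D`, every real primitive `χ (mod D)` satisfying (A), every profile `g` that is `1`-Lipschitz,
bounded by `1` and supported on `[u, v] ⊂ [0, 1+δ]`, the absolute-weight discrete mean of its profile polynomial of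
length `⌈P^{1+δ}⌉` is at most `C·(v − u)·discWeight`. Status: derivation (in-house, unreviewed; S–M); would NOT
close anything if proved (a bound; it completes E-003). Scale: the trivial one (`discWeight`, no `𝔞`).
[cite: Zhang2022LandauSiegel, §7 Prop 7.1 (7.2), §2 (2.16)–(2.20)] -/
def DiscMeanUpperWidth (c' δ : ℝ) : Prop :=
  ∃ C : ℝ, 0 < C ∧ ForAllLarge fun D _ χ => AssumptionA D χ →
    ∀ (g : ℝ → ℂ) (u v : ℝ), LipschitzWith 1 g → (∀ z, ‖g z‖ ≤ 1) → 0 ≤ u → u ≤ v → v ≤ 1 + δ →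
      (∀ z, z < u → g z = 0) → (∀ z, v < z → g z = 0) →
      discMeanAbs c' χ (fun x s => profPoly χ x g ⌈bigP D ^ (1 + δ)⌉₊ s) ≤ C * (v - u) * discWeight c' χ

/-! ### Part 2 — the two instances actually consumed (bare `Prop`s) and their derivation from Part 1 -/

/-- **The near-wall instance** (what CARD-invisible-tail uses): pieces supported in `[1, 1+ε]`, `0 < ε ≤ δ`,
contribute `≤ C·ε·discWeight` — so the part of a profile vanishing at the wall that lives between the wall and the
invisibility threshold `P^{1+ε}` of `KnifeEdgeInvisibleTail.tailInvisible` is `o(discWeight)` as `ε → 0`.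
[cite: Zhang2022LandauSiegel, §7 Prop 7.1 (7.2)] -/
def NearWallBound (c' δ : ℝ) : Prop :=
  ∃ C : ℝ, 0 < C ∧ ∀ ε : ℝ, 0 < ε → ε ≤ δ → ForAllLarge fun D _ χ => AssumptionA D χ →
    ∀ g : ℝ → ℂ, LipschitzWith 1 g → (∀ z, ‖g z‖ ≤ 1) →
      (∀ z, z < 1 → g z = 0) → (∀ z, 1 + ε < z → g z = 0) →
      discMeanAbs c' χ (fun x s => profPoly χ x g ⌈bigP D ^ (1 + δ)⌉₊ s) ≤ C * ε * discWeight c' χ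

/-- **The band instance** (the registry sentence of E-004): pieces supported in the band `[1, 1+α̃(D)]`,
`α̃ = log(Dt₀)/log P` (`Skeleton.alphaTilde`, (2.30)), contribute `≤ C·α̃(D)·discWeight` for all large `D`.
[cite: Zhang2022LandauSiegel, §2 (2.30), §7 Prop 7.1 (7.2)] -/
def BandWidthBound (c' δ : ℝ) : Prop :=
  ∃ C : ℝ, 0 < C ∧ ForAllLarge fun D _ χ => AssumptionA D χ →
    ∀ g : ℝ → ℂ, LipschitzWith 1 g → (∀ z, ‖g z‖ ≤ 1) →
      (∀ z, z < 1 → g z = 0) → (∀ z, 1 + alphaTilde D < z → g z = 0) →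
      discMeanAbs c' χ (fun x s => profPoly χ x g ⌈bigP D ^ (1 + δ)⌉₊ s) ≤
        C * alphaTilde D * discWeight c' χ

/-! ### Part 3 — PROVED: the band width `α̃(D)` is `≥ 0` and eventually below every fixed `ε > 0` -/

/-- `⌈exp L₀⌉ ≤ D` gives `L₀ ≤ 𝓛 = log D`. [folklore] -/
private theorem le_ell_of_ceil_exp_le {L₀ : ℝ} {D : ℕ} (hD : ⌈Real.exp L₀⌉₊ ≤ D) : L₀ ≤ ell D := by
  have h : Real.exp L₀ ≤ (D : ℝ) := (Nat.le_ceil _).trans (by exact_mod_cast hD)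
  exact (Real.le_log_iff_exp_le (lt_of_lt_of_le (Real.exp_pos _) h)).mpr h

/-- `𝓛 = log D ≥ 1` forces `D ≥ 1` (as `log 0 = 0`). [folklore] -/
private theorem one_le_cast_of_one_le_ell {D : ℕ} (hℓ : 1 ≤ ell D) : (1 : ℝ) ≤ D := by
  rcases Nat.eq_zero_or_pos D with h0 | h0
  · exfalso
    subst h0
    norm_num [ell] at hℓ
  · exact_mod_cast h0

/-- `α̃(D) = log(D t₀)/log P ≥ 0` as soon as `𝓛 = log D ≥ 1` (then `D·t₀ = D·𝓛⁵¹⁹ ≥ 1` and `log P = 𝓛⁹ > 0`).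
[cite: Zhang2022LandauSiegel, §2 (2.6), (2.8), (2.30)] -/
theorem alphaTilde_nonneg {D : ℕ} (hℓ : 1 ≤ ell D) : 0 ≤ alphaTilde D := by
  have hℓ0 : 0 < ell D := by linarith
  have hlogP : Real.log (bigP D) = ell D ^ 9 := by rw [bigP, Real.log_exp]
  have hD1 : (1 : ℝ) ≤ D := one_le_cast_of_one_le_ell hℓ
  have ht0 : (1 : ℝ) ≤ t0 D := by
    rw [t0]; exact one_le_pow₀ hℓ
  have hDt : (1 : ℝ) ≤ (D : ℝ) * t0 D := by nlinarith
  rw [alphaTilde, hlogP]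
  exact div_nonneg (Real.log_nonneg hDt) (by positivity)

/-- **The band is thinner than every fixed `ε`:** for every `ε > 0`, for all large `D`, `α̃(D) < ε`
(from `KnifeEdgeInvisibleTail.band_lt_rpow_one_add`: `P·(D t₀) < P^{1+ε}`, i.e. `D t₀ < P^ε`, take logarithms).
[cite: Zhang2022LandauSiegel, §2 (2.6), (2.8), (2.30)] -/
theorem alphaTilde_lt_eventually {ε : ℝ} (hε : 0 < ε) :
    ForAllLarge fun D _ _ => alphaTilde D < ε := by
  have hband := KnifeEdgeInvisibleTail.band_lt_rpow_one_add hε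
  have h3 : ForAllLarge fun D _ _ => (1 : ℝ) ≤ ell D :=
    ForAllLarge.of_le ⌈Real.exp 1⌉₊ fun D _ _ hD _ _ => le_ell_of_ceil_exp_le hD
  refine (hband.and h3).mono fun D _ χ _ _ h => ?_
  obtain ⟨hlt, hℓ⟩ := h
  have hℓ0 : 0 < ell D := by linarith
  have hP : 0 < bigP D := Real.exp_pos _
  have hlogP : Real.log (bigP D) = ell D ^ 9 := by rw [bigP, Real.log_exp]
  have hlogPpos : 0 < Real.log (bigP D) := by rw [hlogP]; positivity
  have ht0 : (1 : ℝ) ≤ t0 D := by rw [t0]; exact one_le_pow₀ hℓ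
  have hD1 : (1 : ℝ) ≤ D := one_le_cast_of_one_le_ell hℓ
  have hDt : (1 : ℝ) ≤ (D : ℝ) * t0 D := by nlinarith
  have hDtpos : (0 : ℝ) < (D : ℝ) * t0 D := by linarith
  -- `D t₀ < P^ε`
  have hquot : (D : ℝ) * t0 D < bigP D ^ ε := by
    have h1 : bigP D ^ (1 + ε) = bigP D * bigP D ^ ε := by
      rw [Real.rpow_add hP, Real.rpow_one]
    rw [h1] at hlt
    exact lt_of_mul_lt_mul_left hlt hP.le
  -- logarithms
  have hlog : Real.log ((D : ℝ) * t0 D) < ε * Real.log (bigP D) := by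
    have := Real.log_lt_log hDtpos hquot
    rwa [Real.log_rpow hP] at this
  rw [alphaTilde]
  exact (div_lt_iff₀ hlogPpos).mpr hlog

/-! ### Part 4 — PROVED: Part 1 implies the two instances -/

/-- `DiscMeanUpperWidth ⇒ NearWallBound` (take `u = 1`, `v = 1 + ε`). [cite: Zhang2022LandauSiegel, §7 Prop 7.1 (7.2)] -/
theorem nearWallBound_of_discMeanUpperWidth {c' δ : ℝ} (h : DiscMeanUpperWidth c' δ) :
    NearWallBound c' δ := by
  obtain ⟨C, hC, hall⟩ := h
  refine ⟨C, hC, fun ε hε hεδ => hall.mono fun D _ χ _ _ hD hA g hg hg1 hlo hhi => ?_⟩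
  have := hD hA g 1 (1 + ε) hg hg1 zero_le_one (by linarith) (by linarith) hlo hhi
  simpa using this

/-- `DiscMeanUpperWidth ⇒ BandWidthBound` for every `δ > 0` (take `u = 1`, `v = 1 + α̃(D)`; admissible for all
large `D` because `0 ≤ α̃(D) < δ` eventually, Part 3). [cite: Zhang2022LandauSiegel, §2 (2.30), §7 Prop 7.1 (7.2)] -/
theorem bandWidthBound_of_discMeanUpperWidth {c' δ : ℝ} (hδ : 0 < δ) (h : DiscMeanUpperWidth c' δ) :
    BandWidthBound c' δ := by
  obtain ⟨C, hC, hall⟩ := h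
  have h3 : ForAllLarge fun D _ _ => (1 : ℝ) ≤ ell D :=
    ForAllLarge.of_le ⌈Real.exp 1⌉₊ fun D _ _ hD _ _ => le_ell_of_ceil_exp_le hD
  refine ⟨C, hC, ((hall.and (alphaTilde_lt_eventually hδ)).and h3).mono fun D _ χ _ _ hD hA g hg hg1 hlo hhi => ?_⟩
  obtain ⟨⟨hW, hlt⟩, hℓ⟩ := hD
  have h0 := alphaTilde_nonneg hℓ
  have := hW hA g 1 (1 + alphaTilde D) hg hg1 zero_le_one (by linarith) (by linarith) hlo hhi
  simpa using this

end KnifeEdge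

end Literature.NumberTheory.LFunctions.Zhang2022

end
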